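import Summits.QuantumFields.BalabanUV.Beta.GAN24.LinT2CoDressed
import Summits.QuantumFields.BalabanUV.Beta.GAN24.CombesThomas
import Summits.QuantumFields.BalabanUV.Beta.HessKerCoDressedBmWall
import Summits.QuantumFields.BalabanUV.Beta.GAN24.Push4

/-!
# `BalabanUV.Beta.GAN24.LinT2CoDressedStep` — binder row G-an2-4 ∕ (CONV-C), CT-W (route (R-HYB)+(R-CT), RULING R-gan24p1-g22-1), PART 2 of `GAN24/LinT2CoDressed`:
# THE DRESSED TOWER'S LINEAR MAP IS ROAD W3's `𝒜_j` ON THE LEG-DRESSED TABLE (adopted units, comb instance) and the leg-dressed table keeps the joint block covariance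

NOT IN PRINT; OUR BOOKKEEPING (G-an2-4 formalisation swarm, leaf prover `b2b-balaban-gan24-formalise-leaf-06`, gen 42; journal OFFER O-leaf06g42-1 l.37044; module name
PROVISIONAL — the row owner gan24-p1 may rename ∕ re-home it).  HONEST FRAMING (cell contract, verbatim): «discharging `BetaPertH` makes Bałaban's UV stability UNCONDITIONAL — a
real constructive-QFT result; it is NOT the continuum limit and NOT the Clay problem.»  HONEST DEPENDENCY (verbatim): «continuum YM on T⁴ ⇐ BetaPertH ∧ nine spine estimates
(0/9 proved); BetaPertH ⇐ (D1) ∧ (D4) ∧ CAP+tail; G-an2-4 gates asym, D1 and NE2/3/4.»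

WHAT ([folklore] BY NAME over PART 1's `lin4_coDressKBmAt`, asym1's `HessKerCoDressedBmWall.unitK_coDressKBmAt`, `HessKerDressedUnits.decays_unitK`, an4∕an2's `decays_KInvStep`, an2's
`coProjBmAt_shift` ∕ `dressKBmAt_shiftK`; 0 `def`, 0 cite, 0 `def … : Prop`, 0 sorry):
* §1 **`lin4_unitK_coDressKBmAt`** (`sf, sm ≠ 0`): `lin4 c (unitK sf sm (coDressKBmAt ρ N K)) N X = lin4 c (unitK sf sm K) N (𝔇 X)`;
  **`lin4_comb_coDressKBmAt`** (every `j`, every in-block root, every `LocStencil₂` table, any `c`):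
  `lin4 c (unitK (sfStep Lc j) (smStep d Lc j) (coDressKBmAt ρ Lc (KInvStep Lc j))) Lc X = lin4 c (unitK (sfStep Lc j) (smStep d Lc j) (KInvStep Lc j)) Lc (𝔇 X)` — gan24-p2's (F1) linear map
  (`T2RecOfUnitSplit` p308181 at the comb slot of `SpineRecursiveW` §3) IS leaf-04's road-W3 map `𝒜_j = lin4 (cE₂·Lc^{2(d+1)}) K♮_j Lc` (`T2RecursionAffine`) on the leg-dressed table
  `𝔇 X κ u κ′ u′ := dressKBmAt ρ Lc (coProjBmAtK ρ Lc (fun κ₁ u₁ ↦ coProjBmAtK ρ Lc (X κ₁ u₁) κ′ u′) κ u)`.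
* §3 **`rowM_coDressKBmAt_eq`**: `rowM (coDressKBmAt ρ N K) N α x′ = coProjBmW ρ N (rowM K N α x′)` — the LEFT kernel-leg family of the dressed step (leaf-17's `rowM`) is the
  `Π_bm`-image of the undressed one, exactly as an2's `colH_coDressKBmAt_eq` says for the other three legs: ALL FOUR leg families of `push₄ (rowM G N) (colH G N)`
  (leaf-17's read identity `mmRead_sandwich_vertex2OfK_eq_push₄`) are `Π_bm`-images — the leg-family form of the exchange, for the row owner's CT-W1 `SandwichLegTelescope`.
* §2 **`translate_dress`**: if `X` is jointly `N`-covariant (`X κ (u + N•t) κ′ (u′ + N•t) = shiftK (−N•t) (X κ u κ′ u′)`, the shape of `vertex2OfK_translate` ∕ `Lin4ZeroMode`'s `hX`),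
  so is `𝔇 X` — the hypothesis under which road W3's rows and leaf-02's (Z0) are stated survives the leg dressing (an2's `dressBmAtS_translate` pattern, two slots).
Asserts NO shape or rate of Bałaban's tables; discharges NOTHING of «T2Shape» ∕ «T2Drift» ∕ (hW, hWall); 0 wall binders; NEVER «G-an2-4 closed» as (CONV-C); NOT D1, NOT `BetaPertH`,
NOT continuum, NOT Clay; not in print — our bookkeeping.  Unit `b2b-balaban-gan24-formalise-leaf-06` (gen 42), 2026-08-21.
-/

noncomputable section

open Finset
open scoped BigOperators
open Literature.MathematicalPhysics.QuantumFieldTheory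
open Literature.MathematicalPhysics.QuantumFieldTheory.Balaban1983to89
open Literature.MathematicalPhysics.QuantumFieldTheory.Balaban1983to89.Beta
open ExpKernelCalculus (MKer Site Decays shiftK comp)
open AffineAveraging (box toSite)
open OneStepResolventKernel (Fib LocStencil decays_mono)
open OneStepKernelFamily (KInvStep decays_KInvStep colH)
open BalabanCompositeJets (LocStencil₂)
open Summit.QuantumFields.BalabanUV.Beta.AxialDressingRooted (pmBm cube piKBm sum_piKBm_col_inl tsum_window' coProjBmAt coProjBmAt_shift coProjBmAtK
  coProjBmAtK_eval coDressKBmAt coDressKBmAt_eq comp_trK_piKBm_inr coProjBmW coProjBmW_apply colH_coDressKBmAt_eq dressKBmAt dressKBmAt_shiftK one_le_of_neZero)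
open Summit.QuantumFields.BalabanUV.Beta.HessKerDressedUnits (unitK decays_unitK)
open Summit.QuantumFields.BalabanUV.Beta.HessKerCoDressedBmWall (unitK_coDressKBmAt)
open Summit.QuantumFields.BalabanUV.Beta.GAN24.BiStencilZeroMode (Tab)
open Summit.QuantumFields.BalabanUV.Beta.GAN24.T2RecursionAffine (lin4)
open Summit.QuantumFields.BalabanUV.Beta.GAN24.CombesThomas (sfStep smStep sfStep_ne_zero smStep_ne_zero)
open Summit.QuantumFields.BalabanUV.Beta.GAN24.LinT2CoDressed (lin4_coDressKBmAt)
open Summit.QuantumFields.BalabanUV.Beta.GAN24.Push4 (rowM rowM_apply)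

namespace Summit.QuantumFields.BalabanUV.Beta.GAN24.LinT2CoDressedStep

variable {d : ℕ}

/-! ## §1 The adopted units: the dressed tower's linear map is road W3's `𝒜_j` on the leg-dressed table -/

/-- [folklore] **LEG UNITS PASS THROUGH THE EXCHANGE** (asym1's `unitK_coDressKBmAt` + `lin4_coDressKBmAt` at `unitK sf sm K`): for nonzero leg-type units,
`lin4 c (unitK sf sm (coDressKBmAt ρ N K)) N X = lin4 c (unitK sf sm K) N (𝔇 X)`. -/
theorem lin4_unitK_coDressKBmAt {N : ℕ} (hN : 1 ≤ N) {r : Fin (d + 1) → ℕ} (hr : r ∈ box (d + 1) N)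
    {K : MKer (d + 1) (Fib d)} {C m : ℝ} (hK : Decays K C m) (hm : 0 < m) {sf sm : ℝ} (hsf : sf ≠ 0) (hsm : sm ≠ 0)
    {X : Tab d} {CX : ℝ} (hX : LocStencil₂ X CX m) (c : ℝ) :
    lin4 c (unitK sf sm (coDressKBmAt (toSite r) N K)) N X
      = lin4 c (unitK sf sm K) N (fun κ u κ' u' => dressKBmAt (toSite r) N
          (coProjBmAtK (toSite r) N (fun κ₁ u₁ => coProjBmAtK (toSite r) N (X κ₁ u₁) κ' u') κ u)) := by
  rw [unitK_coDressKBmAt (toSite r) N hsf hsm K]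
  exact lin4_coDressKBmAt hN hr (decays_unitK hK) hm hX c

/-- [folklore] **THE COMB INSTANCE** (an2's `SpineRecursiveW` §3 resolvent slot `G_j = coDressKBmAt ρ Lc (KInvStep Lc j)` in the adopted units `(sfStep Lc j, smStep d Lc j)`; every `j`,
every in-block root `ρ = toSite r`, every `LocStencil₂` table, any `c`):
`lin4 c (unitK (sfStep Lc j) (smStep d Lc j) (coDressKBmAt ρ Lc (KInvStep Lc j))) Lc X = lin4 c (unitK (sfStep Lc j) (smStep d Lc j) (KInvStep Lc j)) Lc (𝔇 X)` — the linear map of the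
DRESSED `T₂` tower (p2's `T2RecOfUnitSplit` at the comb slot) is road W3's `𝒜_j` (leaf-04's `T2RecursionAffine`, with `c = cE₂·Lc^{2(d+1)}`) applied to the leg-dressed table. -/
theorem lin4_comb_coDressKBmAt {Lc : ℕ} [NeZero Lc] {r : Fin (d + 1) → ℕ} (hr : r ∈ box (d + 1) Lc) (j : ℕ)
    {X : Tab d} {CX δX : ℝ} (hX : LocStencil₂ X CX δX) (hδX : 0 < δX) (c : ℝ) :
    lin4 c (unitK (sfStep Lc j) (smStep d Lc j) (coDressKBmAt (toSite r) Lc (KInvStep (d := d) Lc j))) Lc X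
      = lin4 c (unitK (sfStep Lc j) (smStep d Lc j) (KInvStep (d := d) Lc j)) Lc (fun κ u κ' u' => dressKBmAt (toSite r) Lc
          (coProjBmAtK (toSite r) Lc (fun κ₁ u₁ => coProjBmAtK (toSite r) Lc (X κ₁ u₁) κ' u') κ u)) := by
  have hLc : 1 ≤ Lc := one_le_of_neZero Lc
  obtain ⟨δK, CK, hδK, hCK, hK⟩ := decays_KInvStep (d := d) (Lc := Lc) j
  -- a common rate for the resolvent and the table
  have hm : 0 < min δK δX := lt_min hδK hδX
  have hK' : Decays (KInvStep (d := d) Lc j) CK (min δK δX) := decays_mono hK hCK le_rfl (min_le_left _ _)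
  have hX' : LocStencil₂ X CX (min δK δX) := hX.mono (min_le_right _ _)
  exact lin4_unitK_coDressKBmAt hLc hr hK' hm (sfStep_ne_zero j) (smStep_ne_zero j) hX' c



/-! ## §3 The fourth leg: the mf-row family of the co-dressed kernel is the `Π_bm`-image of the undressed one -/

/-- [folklore] **THE LEFT KERNEL LEG OF THE DRESSED STEP** (twin of an2's `colH_coDressKBmAt` for leaf-17's `rowM`; any root offset, any `N`, any `K` — finite window
sums only): `rowM (coDressKBmAt ρ N K) N α x′ κ x = Σ_{v ∈ cube} Σ_γ pmBm ρ N κ x γ (x − v) · rowM K N α x′ γ (x − v)`. -/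
theorem rowM_coDressKBmAt (ρ : Fin (d + 1) → ℤ) (N : ℕ) (K : MKer (d + 1) (Fib d)) (α : Fin (d + 1)) (x' : Fin (d + 1) → ℤ)
    (κ : Fin (d + 1)) (x : Fin (d + 1) → ℤ) :
    rowM (coDressKBmAt ρ N K) N α x' κ x
      = ∑ v ∈ cube (d + 1) N, ∑ γ : Fin (d + 1), pmBm ρ N κ x γ (x - v) * rowM K N α x' γ (x - v) := by
  simp only [rowM_apply]
  rw [coDressKBmAt_eq]
  show (∑' z, ∑ f : Fib d, comp (TameKernelCalculus.trK (piKBm ρ N)) K ((N : ℤ) • x') z (Sum.inr α) f * piKBm ρ N z x f (Sum.inl κ)) = _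
  simp_rw [comp_trK_piKBm_inr]
  have h : ∀ z, ∑ f : Fib d, K ((N : ℤ) • x') z (Sum.inr α) f * piKBm ρ N z x f (Sum.inl κ)
      = if x - z ∈ cube (d + 1) N then ∑ γ : Fin (d + 1), pmBm ρ N κ x γ z * K ((N : ℤ) • x') z (Sum.inr α) (Sum.inl γ) else 0 := by
    intro z
    rw [← sum_piKBm_col_inl ρ N z x κ (fun f => K ((N : ℤ) • x') z (Sum.inr α) f)]
    exact Finset.sum_congr rfl fun f _ => mul_comm _ _
  simp_rw [h]
  rw [tsum_window']

/-- [folklore] **ALL FOUR LEGS OF THE DRESSED STEP ARE `Π_bm`-IMAGES** (window-operator form): `rowM (coDressKBmAt ρ N K) N α x′ = coProjBmW ρ N (rowM K N α x′)`,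
next to an2's `colH_coDressKBmAt_eq : colH (coDressKBmAt ρ N K) N μ y = coProjBmW ρ N (colH K N μ y)` for the two source legs and the right kernel leg. -/
theorem rowM_coDressKBmAt_eq (ρ : Fin (d + 1) → ℤ) (N : ℕ) (K : MKer (d + 1) (Fib d)) (α : Fin (d + 1)) (x' : Fin (d + 1) → ℤ) :
    rowM (coDressKBmAt ρ N K) N α x' = coProjBmW ρ N (rowM K N α x') :=
  funext fun κ => funext fun x => by rw [rowM_coDressKBmAt, coProjBmW_apply]

/-! ## §2 The leg-dressed table keeps the joint block covariance -/

/-- [folklore] **JOINT BLOCK COVARIANCE SURVIVES THE LEG DRESSING** (an2's `coProjBmAt_shift` on each source slot, `dressKBmAt_shiftK` on the kernel legs; any root offset `ρ`, `1 ≤ N`):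
if `X κ (u + N•t) κ′ (u′ + N•t) = shiftK (−N•t) (X κ u κ′ u′)` for all `κ u κ′ u′ t`, then the same holds for `𝔇 X`. -/
theorem translate_dress (ρ : Fin (d + 1) → ℤ) {N : ℕ} (hN : 1 ≤ N) {X : Tab d}
    (hX : ∀ κ u κ' u' t, X κ (u + (N : ℤ) • t) κ' (u' + (N : ℤ) • t) = shiftK (-((N : ℤ) • t)) (X κ u κ' u'))
    (κ : Fin (d + 1)) (u : Fin (d + 1) → ℤ) (κ' : Fin (d + 1)) (u' t : Fin (d + 1) → ℤ) :
    dressKBmAt ρ N (coProjBmAtK ρ N (fun κ₁ u₁ => coProjBmAtK ρ N (X κ₁ u₁) κ' (u' + (N : ℤ) • t)) κ (u + (N : ℤ) • t))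
      = shiftK (-((N : ℤ) • t)) (dressKBmAt ρ N (coProjBmAtK ρ N (fun κ₁ u₁ => coProjBmAtK ρ N (X κ₁ u₁) κ' u') κ u)) := by
  -- the doubly co-projected table is jointly covariant (an2's `coProjBmAt_shift`, inner slot then outer slot)
  have h1 : coProjBmAtK ρ N (fun κ₁ u₁ => coProjBmAtK ρ N (X κ₁ u₁) κ' (u' + (N : ℤ) • t)) κ (u + (N : ℤ) • t)
      = shiftK (-((N : ℤ) • t)) (coProjBmAtK ρ N (fun κ₁ u₁ => coProjBmAtK ρ N (X κ₁ u₁) κ' u') κ u) := by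
    funext x z a b
    show coProjBmAtK ρ N (fun κ₁ u₁ => coProjBmAtK ρ N (X κ₁ u₁) κ' (u' + (N : ℤ) • t)) κ (u + (N : ℤ) • t) x z a b
      = coProjBmAtK ρ N (fun κ₁ u₁ => coProjBmAtK ρ N (X κ₁ u₁) κ' u') κ u (x + -((N : ℤ) • t)) (z + -((N : ℤ) • t)) a b
    rw [coProjBmAtK_eval, coProjBmAtK_eval,
      ← coProjBmAt_shift ρ hN (fun κ₁ u₁ => coProjBmAtK ρ N (X κ₁ u₁) κ' (u' + (N : ℤ) • t) x z a b) t κ u]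
    congr 1
    funext κ₁ u₁
    show coProjBmAtK ρ N (X κ₁ (u₁ + (N : ℤ) • t)) κ' (u' + (N : ℤ) • t) x z a b
      = coProjBmAtK ρ N (X κ₁ u₁) κ' u' (x + -((N : ℤ) • t)) (z + -((N : ℤ) • t)) a b
    rw [coProjBmAtK_eval, coProjBmAtK_eval,
      ← coProjBmAt_shift ρ hN (fun κ₂ u₂ => X κ₁ (u₁ + (N : ℤ) • t) κ₂ u₂ x z a b) t κ' u']
    congr 1
    funext κ₂ u₂
    show X κ₁ (u₁ + (N : ℤ) • t) κ₂ (u₂ + (N : ℤ) • t) x z a b = X κ₁ u₁ κ₂ u₂ (x + -((N : ℤ) • t)) (z + -((N : ℤ) • t)) a b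
    rw [hX κ₁ u₁ κ₂ u₂ t]
    rfl
  rw [h1, dressKBmAt_shiftK ρ hN]

end Summit.QuantumFields.BalabanUV.Beta.GAN24.LinT2CoDressedStep

end
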